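import Literature.MathematicalPhysics.QuantumFieldTheory.Balaban1983to89.B15Prop1JointHolomorphyFromMinimiserFamily

/-!
# `Balaban1983to89.B15Prop1NearValueOfMinimiserFamily` — [Balaban1989LargeFieldI] = «[IV]», (1.74) p. 192, (1.77) and Prop. 1 p. 194; [Balaban1989LargeFieldII] = «[LF-II]»,
# (1.2)–(1.6) p. 357, p. 359; [Balaban1985Variational] = «[15]», (5) p. 278, Prop. 9 (190) p. 309; [Balaban1988Convergent] = «[III]», (2.12)–(2.13) pp. 256–257:
# (J1ˢ) ⇐ (J0′) — THE JOINT HOLOMORPHIC EXTENSION OF THE NEAR VALUE OF (1.77) FROM A HOLOMORPHIC FAMILY OF (2.12) MINIMISERS, WITH THE NEAR PLAQUETTE COUNT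

Honest framing: statement-level skeleton of published theorems with citation tags; proofs where landed; nothing here is a claim about the
Yang–Mills mass gap.  Cell `pub-ymgap`, HUMAN RULING D-0062 (Track A), seat `pub-ymgap-dag-n12-c` g23 (lane owner N12 = [B15], strategy s1; census axis U3 of the lane memo
`N12-UNIFORMITY-SPEC.md` §4 v2); count-neutral; N12 NOT discharged; finite 𝕋⁴ at fixed ε; nothing continuum ∕ OS ∕ mass-gap ∕ Clay.

WHY.  The N12∕s1 gradient road reads the gradient of print's function (1.77) at the extended datum off the NEAR value `h` = the action of `U_{k,Z}` over the plaquettes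
meeting `Ω₁(Z)` (`B15Prop1GradientFromNearValue`, [IV] (1.74) *«It is defined in each component of Z separately»*).  Its v1.1 §4 (`hJ_of_nearValue_nearExt` and the
two Proposition-1 endpoints `…_ofNearValue_nearExt`) reads that gradient through ANY bounded holomorphic extension of `h` itself — the displayed letter (J1ˢ) `hGjS`,
bound `𝓐S` — instead of the extension of the TOTAL typed (1.77) (bound `|Plaq(T_η)|·(1+8𝓐₀⁴)`, the TORUS count, `B15Prop1JointHolomorphyFromBackground.norm_actionSum_le`).
THIS MODULE inhabits (J1ˢ) from the road's configuration letter (J0′) of `B15Prop1JointHolomorphyFromMinimiserFamily` («one holomorphic bounded `M₂(ℂ)`-family on the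
sup-ball which at every real point IS SOME (2.12) minimiser of the datum», [15] Prop. 9 (190)) with `𝓐S := #plaqsOf(Ω₁(Z))·(1 + 8𝓐₀⁴)` — the NEAR plaquette count:
the trace polynomial of the family summed over the near plaquettes only (`B15Prop1JointHolomorphyFromBackground.jointHolomorphic_nearAction_of_cfgFamily`, v1.1 §5) is,
at every real point, the near action of SOME minimiser `U′`; and the near action is the SAME for every minimiser of one (2.12) problem — two minimisers have one total
action (the minimum) and one far action (both are pinned to the datum off `Ω₁(Z)`, `B15Prop1GradientFromNearValue.isMinimizer_pinned`, [III] (1.12) *«U = V₀ on Ω₁ᶜ»*),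
hence one near action ([LF-II] (1.15) `A = A(ζ₀) + A(1 − ζ₀)`, `B16Sect1Wilson.eq115`) — in particular that of NODE 00's selected minimiser `UminOfRecord` behind
`bgKZstd (Node00.bgOfRecord av reg)` (dag-n12-w1's LOCATED-SELECTOR is respected: only minimiser-INDEPENDENT quantities are matched).

CONTENTS (theorems only; no `def`, no `instance`, no `sorry`; axioms standard).
* §1 `wilsonAction4_eq_of_isMinimizer` (two minimisers of one problem have one action) · `farValue_eq_of_isMinimizer` (and one far action, `0 < k`) ·
  ★ `nearValue_eq_of_isMinimizer` (hence one near action) · `nearValue_bgKZstd_bgOfRecord_eq_of_isMinimizer` (= that of the selected minimiser of record) ·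
  `sum_filter_one_sub_reTr_eq_wilsonLoc` (bookkeeping: `Σ_{q ∈ plaqsOf Y} (1 − Re tr U(∂q))` is `wilsonLoc 1_{plaqsOf Y} U`).
* §2 ★★ `jointHolomorphic_nearValue_bgOfRecord_of_minimiserFamily` — (J1ˢ) ⇐ (J0′) at `Node00.bgOfRecord av reg` with `𝓐S = #plaqsOf(Ω₁(Z))·(1+8𝓐₀⁴)`;
  ★★ `jointHolomorphic_nearValue_bgMSCoPOfRecord_of_minimiserFamily` — the same at NODE 00's (2.12) datum of record `Node00.bgMSCoPOfRecord F 2 ν K k Ω` (the form the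
  N12 endpoints read).
After this module the v1.1 §4 endpoints of `B15Prop1GradientFromNearValue` are consumable in the road of record with NO new displayed letter: (J1ˢ) is served by (J0′)
exactly as (J1) is (`jointHolomorphic_fun177std_bgOfRecord_of_minimiserFamily`), and the gradient constant `hcJ'` reads `#plaqsOf(Ω₁(Z_i))` where it read `|Plaq(T_η)|`.
HONEST SCOPE: count-neutral junction; (J0′) stays NODE 00's∕N07's letter ([15] Thm 1 + Prop. 9); the clause's analyticity radius of the endpoints still reads the TOTAL bound;
NOT a discharge of N12; nothing continuum ∕ OS ∕ mass-gap ∕ Clay.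
-/

noncomputable section

open Set Metric Finset
namespace Literature.MathematicalPhysics.QuantumFieldTheory.Balaban1983to89.B15Prop1NearValueOfMinimiserFamily

open T4Continuum B15DeterminingSets GaugeField B15Prop1Carrier B8Eq17ClassAkV1 BlockAveraging
open Literature.MathematicalPhysics.QuantumFieldTheory.BalabanImbrieJaffe1984to88.BIJ85Eq453GaugeField (qsstarGIter0)
open B15Prop1JointHolomorphyFromBackground B15Prop1ValueOfAnyMinimiser B15Prop1JointHolomorphyFromMinimiserFamily
open B15Prop1GradientFromNearValue (isMinimizer_pinned plaqHol_congr_of_not_mem_plaqsOf wilsonLoc_congr)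
open B14.Eq213DetSet B15Sect1Instances B16Sect1Backgrounds B16Sect1Wilson
open B15Prop1AnalyticExtClause (cplxVec)
open B15Prop1ChartCalculusSU2 (E3)
open B15Prop1ChartSU2 (su2Chart)
open T4CubeChartGnomonic (SU2)
open scoped BigOperators

/-! ## §1  Two minimisers of one (2.12) problem have one near action -/

section NearValue

open Classical

variable {P : Params} {G : Type*} [GaugeGroup G]

/-- Two minimal configurations of ONE (2.12) problem (class `reg`, determining set `𝔹`, data `V`) have the same action — each is admissible for the other's
minimality clause. [cite: Balaban1988Convergent, (2.12) p.256; Balaban1985Variational, (5) p.278] -/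
theorem wilsonAction4_eq_of_isMinimizer {av : ∀ j, Averaging P j G} {reg : Set (GaugeField P 0 G)} {𝔹 : DetSet P} {V : MSField P G}
    {U₁ U₂ : GaugeField P 0 G} (h₁ : IsMinimizer av reg 𝔹 V U₁) (h₂ : IsMinimizer av reg 𝔹 V U₂) :
    wilsonAction4 U₁ = wilsonAction4 U₂ :=
  le_antisymm (h₁.2.2 U₂ h₂.1 h₂.2.1) (h₂.2.2 U₁ h₁.1 h₁.2.1)

/-- Two minimal configurations of the (2.12) problem for `𝐁_k(Z)`, `0 < k`, and data `M˙(W)` have the same FAR action (the localized Wilson action at any weight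
vanishing on the plaquettes meeting `Ω₁(Z)`): both are pinned to `W` on every bond starting outside `Ω₁(Z)` ([III] (1.12) *«U = V₀ on Ω₁ᶜ»*,
`B15Prop1GradientFromNearValue.isMinimizer_pinned`), and a plaquette without a corner in `Ω₁(Z)` reads only such bonds.
[cite: Balaban1988Convergent, (1.12) p.248, (2.12)–(2.13) pp.256–257; Balaban1989LargeFieldII, (1.15) p.359] -/
theorem farValue_eq_of_isMinimizer {av : ∀ j, Averaging P j G} {reg : Set (GaugeField P 0 G)} {M₁ : ℕ} {Z : Set (Site P 0)} {k : ℕ} (hk0 : 0 < k)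
    {W U₁ U₂ : GaugeField P 0 G} (h₁ : IsMinimizer av reg (Bj M₁ Z k) (avgFamily av W) U₁) (h₂ : IsMinimizer av reg (Bj M₁ Z k) (avgFamily av W) U₂)
    (ζ : Plaq P 0 → ℝ) (hζ : ∀ p, ζ p ≠ 0 → p ∉ plaqsOf (maxDomT M₁ Z 1)) :
    wilsonLoc ζ U₁ = wilsonLoc ζ U₂ :=
  wilsonLoc_congr ζ fun p hp =>
    plaqHol_congr_of_not_mem_plaqsOf (fun b hb => by rw [isMinimizer_pinned hk0 h₁ b hb, isMinimizer_pinned hk0 h₂ b hb]) (hζ p hp)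

/-- ★ **TWO MINIMISERS OF ONE (2.12) PROBLEM HAVE ONE NEAR ACTION** (`0 < k`, data `M˙(W)`): `Σ_{p ∈ plaqsOf Ω₁(Z)} (1 − Re tr U₁(∂p)) = Σ_{p ∈ plaqsOf Ω₁(Z)} (1 − Re tr U₂(∂p))`
— total actions agree (`wilsonAction4_eq_of_isMinimizer`), far actions agree (`farValue_eq_of_isMinimizer`), and `A = A(ζ₀) + A(1 − ζ₀)` (`B16Sect1Wilson.eq115`).  This is
what lets the N12 road match the NEAR value of NODE 00's selected minimiser by that of ANY minimiser (dag-n12-w1's LOCATED-SELECTOR respected).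
[cite: Balaban1989LargeFieldII, (1.15) p.359, (1.2)–(1.6) p.357; Balaban1988Convergent, (2.12)–(2.13) pp.256–257; Balaban1989LargeFieldI, (1.74) p.192] -/
theorem nearValue_eq_of_isMinimizer {av : ∀ j, Averaging P j G} {reg : Set (GaugeField P 0 G)} {M₁ : ℕ} {Z : Set (Site P 0)} {k : ℕ} (hk0 : 0 < k)
    {W U₁ U₂ : GaugeField P 0 G} (h₁ : IsMinimizer av reg (Bj M₁ Z k) (avgFamily av W) U₁) (h₂ : IsMinimizer av reg (Bj M₁ Z k) (avgFamily av W) U₂) :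
    wilsonLoc ((plaqsOf (maxDomT M₁ Z 1)).indicator fun _ => (1 : ℝ)) U₁ = wilsonLoc ((plaqsOf (maxDomT M₁ Z 1)).indicator fun _ => (1 : ℝ)) U₂ := by
  have hζfar : ∀ p : Plaq P 0, 1 - (plaqsOf (maxDomT M₁ Z 1)).indicator (fun _ => (1 : ℝ)) p ≠ 0 → p ∉ plaqsOf (maxDomT M₁ Z 1) := by
    intro p hp hmem
    apply hp
    simp only [Set.indicator_of_mem hmem, sub_self]
  have htot := wilsonAction4_eq_of_isMinimizer h₁ h₂
  rw [eq115 ((plaqsOf (maxDomT M₁ Z 1)).indicator fun _ => (1 : ℝ)) U₁, eq115 ((plaqsOf (maxDomT M₁ Z 1)).indicator fun _ => (1 : ℝ)) U₂,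
    farValue_eq_of_isMinimizer hk0 h₁ h₂ _ hζfar] at htot
  linarith

/-- **THE NEAR VALUE OF THE SELECTED MINIMISER OF RECORD IS THAT OF ANY MINIMISER**: at NODE 00's totalised (2.12) solution map `bg := Node00.bgOfRecord av reg` (any class `reg`),
`0 < k`, if `U′` is a minimal configuration of the problem for the datum `M˙(Q_k^{s*}V)`, then the near action of `U_{k,Z}(V) = bgKZstd bg M₁ Z k V` (the `Classical.choose`-selected
minimiser `UminOfRecord`, itself a minimiser since the problem is solvable) equals that of `U′`. [cite: Balaban1988Convergent, (2.12)–(2.13) pp.256–257; Balaban1989LargeFieldI, (1.74) p.192;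
Balaban1989LargeFieldII, (1.15) p.359] -/
theorem nearValue_bgKZstd_bgOfRecord_eq_of_isMinimizer (av : ∀ j, Averaging P j SU2) (reg : Set (GaugeField P 0 SU2)) {M₁ : ℕ} {Z : Set (Site P 0)} {k : ℕ}
    (hk0 : 0 < k) {V : GaugeField P k SU2} {U' : GaugeField P 0 SU2} (hU' : IsMinimizer av reg (Bj M₁ Z k) (avgFamily av (qsstarGIter0 k V)) U') :
    wilsonLoc ((plaqsOf (maxDomT M₁ Z 1)).indicator fun _ => (1 : ℝ)) (bgKZstd (Node00.bgOfRecord av reg) M₁ Z k V) =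
      wilsonLoc ((plaqsOf (maxDomT M₁ Z 1)).indicator fun _ => (1 : ℝ)) U' := by
  have hU : bgKZstd (Node00.bgOfRecord av reg) M₁ Z k V = Node00.UminOfRecord av reg (Bj M₁ Z k) (avgFamily av (qsstarGIter0 k V)) := by
    rw [bgKZstd_apply, Node00.bgOfRecord_U]
  rw [hU]
  exact nearValue_eq_of_isMinimizer hk0 (Node00.isMinimizer_UminOfRecord av reg ⟨U', hU'⟩) hU'

/-- Bookkeeping: the near action written as a filtered sum, `Σ_{q ∈ plaqsOf Y} (1 − Re tr U(∂q)) = wilsonLoc 1_{plaqsOf Y} U`. [cite: Balaban1989LargeFieldII, (1.1) p.356 (bookkeeping)] -/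
theorem sum_filter_one_sub_reTr_eq_wilsonLoc {j : ℕ} (Y : Set (Site P j)) (U : GaugeField P j G) :
    ∑ q ∈ Finset.univ.filter (fun q : Plaq P j => q ∈ plaqsOf Y), ((1 : ℝ) - reTr (plaqHol U q)) =
      wilsonLoc ((plaqsOf Y).indicator fun _ => (1 : ℝ)) U := by
  classical
  unfold wilsonLoc
  rw [Finset.sum_filter]
  refine Finset.sum_congr rfl fun q _ => ?_
  by_cases hq : q ∈ plaqsOf Y
  · simp only [if_pos hq, Set.indicator_of_mem hq, one_mul]
  · simp only [if_neg hq, Set.indicator_of_notMem hq, zero_mul]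

end NearValue

/-! ## §2  (J1ˢ) ⇐ (J0′): the joint holomorphic extension of the NEAR value from a holomorphic family of minimisers, with the near count -/

section OfRecord

open Classical

variable {P : Params}

/-- ★★ **(J1ˢ) FROM A HOLOMORPHIC FAMILY OF MINIMISERS, at NODE 00's totalised (2.12) solution map** `bg := Node00.bgOfRecord av reg` (any class `reg`), `0 < k`: under the road's
configuration letter (J0′) — ONE family `Ũ` of bond matrices on the sup-ball of radius `R`, ℂ-differentiable entries bounded by `𝓐₀ ≥ 0`, which at every REAL point `(p, B′)` IS some
`SU(2)` MINIMAL CONFIGURATION `U′` of the (2.12) problem for the datum `M˙(Q_k^{s*}(exp(iB′)·ext(exp(ip)V_k)))` — the NEAR value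
`(p, B′) ↦ Σ_{q ∈ plaqsOf Ω₁(Z)} (1 − Re tr U_{k,Z}(exp(iB′)·ext(exp(ip)V_k))(∂q))` is the real trace of ONE ℂ-differentiable `𝒢ˢ` on that ball with
`‖𝒢ˢ‖ ≤ #plaqsOf(Ω₁(Z)) · (1 + 8𝓐₀⁴)` (`#` = `Nat.card` of the subtype, instance-free, the knit's style) — the letter (J1ˢ) `hGjS` of `B15Prop1GradientFromNearValue` v1.1 §4, with the NEAR plaquette count.  Two lines: the near trace polynomial of
the family (`jointHolomorphic_nearAction_of_cfgFamily`) is at real points the near action of `U′`, which is that of the selected minimiser (`nearValue_bgKZstd_bgOfRecord_eq_of_isMinimizer`).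
[cite: Balaban1989LargeFieldI, (1.74) p.192, (1.77) and Prop. 1 p.194; Balaban1989LargeFieldII, (1.2)–(1.6) p.357, p.359; Balaban1985Variational, Prop. 9 (190) p.309; Balaban1988Convergent, (2.12) p.256] -/
theorem jointHolomorphic_nearValue_bgOfRecord_of_minimiserFamily (av : ∀ j, Averaging P j SU2) (reg : Set (GaugeField P 0 SU2))
    (M₁ : ℕ) (Z : Set (Site P 0)) (k : ℕ) (hk0 : 0 < k) (ext : GaugeField P k SU2 → GaugeField P k SU2) (Vk : GaugeField P k SU2) {R 𝓐₀ : ℝ} (h𝓐₀ : 0 ≤ 𝓐₀)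
    (hMin : ∃ Ũ : VecField P k (EuclideanSpace ℂ (Fin 3)) × VecField P k (EuclideanSpace ℂ (Fin 3)) → PBond P 0 → Matrix (Fin 2) (Fin 2) ℂ,
      (∀ b a c, DifferentiableOn ℂ (fun z => Ũ z b a c) (ball 0 R)) ∧
      (∀ z ∈ ball (0 : VecField P k (EuclideanSpace ℂ (Fin 3)) × VecField P k (EuclideanSpace ℂ (Fin 3))) R, ∀ b a c, ‖Ũ z b a c‖ ≤ 𝓐₀) ∧
      ∀ p B' : VecField P k E3, ‖p‖ < R → ‖B'‖ < R → ∃ U' : GaugeField P 0 SU2,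
        (∀ b, Ũ (cplxVec p, cplxVec B') b = ((U' b : SU2) : Matrix (Fin 2) (Fin 2) ℂ)) ∧
          IsMinimizer av reg (Bj M₁ Z k) (avgFamily av (qsstarGIter0 k (expMul su2Chart B' (ext (expMul su2Chart p Vk))))) U') :
    ∃ 𝒢S : VecField P k (EuclideanSpace ℂ (Fin 3)) × VecField P k (EuclideanSpace ℂ (Fin 3)) → ℂ,
      DifferentiableOn ℂ 𝒢S (ball 0 R) ∧
      (∀ z ∈ ball (0 : VecField P k (EuclideanSpace ℂ (Fin 3)) × VecField P k (EuclideanSpace ℂ (Fin 3))) R,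
        ‖𝒢S z‖ ≤ (Nat.card {q : Plaq P 0 // q ∈ plaqsOf (maxDomT M₁ Z 1)} : ℝ) * (1 + 8 * 𝓐₀ ^ 4)) ∧
      ∀ p B' : VecField P k E3, ‖p‖ < R → ‖B'‖ < R →
        𝒢S (cplxVec p, cplxVec B') =
          ((wilsonLoc ((plaqsOf (maxDomT M₁ Z 1)).indicator fun _ => (1 : ℝ))
            (bgKZstd (Node00.bgOfRecord av reg) M₁ Z k (expMul su2Chart B' (ext (expMul su2Chart p Vk)))) : ℝ) : ℂ) := by
  classical
  obtain ⟨Ũ, hdiff, hbd, hreal⟩ := hMin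
  obtain ⟨𝒢, hd, hb, hr⟩ := jointHolomorphic_nearAction_of_cfgFamily (Finset.univ.filter fun q : Plaq P 0 => q ∈ plaqsOf (maxDomT M₁ Z 1)) h𝓐₀ hdiff hbd
  have hcard : ((Finset.univ.filter fun q : Plaq P 0 => q ∈ plaqsOf (maxDomT M₁ Z 1)).card : ℝ) =
      (Nat.card {q : Plaq P 0 // q ∈ plaqsOf (maxDomT M₁ Z 1)} : ℝ) := by
    rw [Nat.card_eq_fintype_card, Fintype.card_subtype]
  refine ⟨𝒢, hd, fun z hz => hcard ▸ hb z hz, fun p B' hp hB' => ?_⟩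
  obtain ⟨U', hU', hmin⟩ := hreal p B' hp hB'
  rw [hr p B' hp hB' U' hU', nearValue_bgKZstd_bgOfRecord_eq_of_isMinimizer av reg hk0 hmin, ← sum_filter_one_sub_reTr_eq_wilsonLoc]
  push_cast
  rfl

end OfRecord

section Record

open Classical

variable {F : T4Family}

/-- ★★ **(J1ˢ) FROM A HOLOMORPHIC FAMILY OF MINIMISERS, at NODE 00's (2.12) datum of record** `Node00.bgMSCoPOfRecord F 2 ν K k Ω` (the class `regMSCoPOfRecord F 2 ν K k Ω` = [15] (2) on the
support of record), `0 < k′`: the form in which the N12 endpoints read the letter.  (J0′) ⇒ (J1ˢ) for the near value of `bgKZstd (bgMSCoPOfRecord …)` with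
`𝓐S = #plaqsOf(Ω₁(Z))·(1 + 8𝓐₀⁴)`. [cite: Balaban1989LargeFieldI, (1.74) p.192, (1.77) and Prop. 1 p.194; Balaban1989LargeFieldII, (1.2)–(1.6) p.357, p.359; Balaban1985Variational, (2) p.278,
Prop. 9 (190) p.309; Balaban1988Convergent, (2.12) p.256, p.255] -/
theorem jointHolomorphic_nearValue_bgMSCoPOfRecord_of_minimiserFamily (ν : Node00.Stage7Numerics) (K k : ℕ) (Ω : ℕ → Set (Site (F.P K) 0))
    (M₁ : ℕ) (Z : Set (Site (F.P K) 0)) (k' : ℕ) (hk0 : 0 < k') (ext : GaugeField (F.P K) k' SU2 → GaugeField (F.P K) k' SU2)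
    (Vk : GaugeField (F.P K) k' SU2) {R 𝓐₀ : ℝ} (h𝓐₀ : 0 ≤ 𝓐₀)
    (hMin : ∃ Ũ : VecField (F.P K) k' (EuclideanSpace ℂ (Fin 3)) × VecField (F.P K) k' (EuclideanSpace ℂ (Fin 3)) →
        PBond (F.P K) 0 → Matrix (Fin 2) (Fin 2) ℂ,
      (∀ b a c, DifferentiableOn ℂ (fun z => Ũ z b a c) (ball 0 R)) ∧
      (∀ z ∈ ball (0 : VecField (F.P K) k' (EuclideanSpace ℂ (Fin 3)) × VecField (F.P K) k' (EuclideanSpace ℂ (Fin 3))) R,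
        ∀ b a c, ‖Ũ z b a c‖ ≤ 𝓐₀) ∧
      ∀ p B' : VecField (F.P K) k' E3, ‖p‖ < R → ‖B'‖ < R → ∃ U' : GaugeField (F.P K) 0 SU2,
        (∀ b, Ũ (cplxVec p, cplxVec B') b = ((U' b : SU2) : Matrix (Fin 2) (Fin 2) ℂ)) ∧
          IsMinimizer (Node00.avOfRecord F 2 K) (Node00.regMSCoPOfRecord F 2 ν K k Ω) (Bj M₁ Z k')
            (avgFamily (Node00.avOfRecord F 2 K) (qsstarGIter0 k' (expMul su2Chart B' (ext (expMul su2Chart p Vk))))) U') :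
    ∃ 𝒢S : VecField (F.P K) k' (EuclideanSpace ℂ (Fin 3)) × VecField (F.P K) k' (EuclideanSpace ℂ (Fin 3)) → ℂ,
      DifferentiableOn ℂ 𝒢S (ball 0 R) ∧
      (∀ z ∈ ball (0 : VecField (F.P K) k' (EuclideanSpace ℂ (Fin 3)) × VecField (F.P K) k' (EuclideanSpace ℂ (Fin 3))) R,
        ‖𝒢S z‖ ≤ (Nat.card {q : Plaq (F.P K) 0 // q ∈ plaqsOf (maxDomT M₁ Z 1)} : ℝ) * (1 + 8 * 𝓐₀ ^ 4)) ∧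
      ∀ p B' : VecField (F.P K) k' E3, ‖p‖ < R → ‖B'‖ < R →
        𝒢S (cplxVec p, cplxVec B') =
          ((wilsonLoc ((plaqsOf (maxDomT M₁ Z 1)).indicator fun _ => (1 : ℝ))
            (bgKZstd (Node00.bgMSCoPOfRecord F 2 ν K k Ω) M₁ Z k' (expMul su2Chart B' (ext (expMul su2Chart p Vk)))) : ℝ) : ℂ) :=
  jointHolomorphic_nearValue_bgOfRecord_of_minimiserFamily (Node00.avOfRecord F 2 K) (Node00.regMSCoPOfRecord F 2 ν K k Ω) M₁ Z k' hk0 ext Vk h𝓐₀ hMin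

end Record

end Literature.MathematicalPhysics.QuantumFieldTheory.Balaban1983to89.B15Prop1NearValueOfMinimiserFamily

end
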